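import Literature.NumberTheory.LFunctions.Zhang2022.RepairBedLadderCertificatesDeep
import HarnessLib

/-!
# Zhang (2022) rescue bed (D-0124 (3)): stride-8 sweep certificates toward the ladder rung `D_83^− = −114148483`, file b
# of 5 (chunks 12515141, 12674543, 12833945)

Topic `Literature/NumberTheory/LFunctions/Zhang2022` (Landau–Siegel audit tree; verdict-neutral), cell landau-siegel, LS RESCUE PROTOCOL
(D-0124) part (3) GENUINE BED, typer seat ls-rescue-typ-1. **Nothing here is a claim about Landau–Siegel zeros; the programme SEARCHES
and TYPES; no claim about Landau–Siegel zeros, Theorems 1–2 of arXiv:2211.02515 or a repaired Margin232 until a kernel theorem says so.**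
Pure CERTIFICATE file (theorems only): pieces of the minimality sweep for the rule-`L1y` rung `D_83^−` of bed-1's spec `bed1-KG1-v0.1`
(Lehmer–Lehmer–Shanks 1970): `sweep8 (allInertCheckNeg 83) (8m₀ + 3) n = true` says that no `N = 8m + 3`, `m₀ ≤ m < m₀ + n`, has all
primes `≤ 83` inert for `D = −N` (`RepairBedLadderCertificatesDeep.sweep8_sound`, `allInertCheck_neg_false_of_sweep8`; the other residues
mod `8` fail at the prime `2`). The whole range `96295483 ≤ N < 114148483` takes 14 such chunks of ≈ one minute of kernel time
(three per file); the assembly into `sweep83_neg` and **`isLeastAllInert_neg114148483`** is `RepairBedLadderCertificatesDeepNeg2.lean`.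

## References

* [LehmerLehmerShanks1970] D. H. Lehmer, E. Lehmer, D. Shanks, *Integer sequences having prescribed quadratic character*,
  Math. Comp. 24 (1970) 433–451, §1 and Tables.
-/

namespace Literature.NumberTheory.LFunctions.Zhang2022.Repair.Bed

/-- Stride-8 certificate chunk at `y = 83`: every `N ≡ 3 (mod 8)` with `100121131 ≤ N ≤ 101396339` fails the all-inert check
(`159402` evaluations, one kernel declaration). [cite: LehmerLehmerShanks1970, §1] -/
theorem sweep83_neg_cert_12515141 : sweep8 (allInertCheckNeg 83) (8 * 12515141 + 3) 159402 = true := by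
  decide +kernel

/-- Stride-8 certificate chunk at `y = 83`: every `N ≡ 3 (mod 8)` with `101396347 ≤ N ≤ 102671555` fails the all-inert check
(`159402` evaluations, one kernel declaration). [cite: LehmerLehmerShanks1970, §1] -/
theorem sweep83_neg_cert_12674543 : sweep8 (allInertCheckNeg 83) (8 * 12674543 + 3) 159402 = true := by
  decide +kernel

/-- Stride-8 certificate chunk at `y = 83`: every `N ≡ 3 (mod 8)` with `102671563 ≤ N ≤ 103946771` fails the all-inert check
(`159402` evaluations, one kernel declaration). [cite: LehmerLehmerShanks1970, §1] -/
theorem sweep83_neg_cert_12833945 : sweep8 (allInertCheckNeg 83) (8 * 12833945 + 3) 159402 = true := by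
  decide +kernel

end Literature.NumberTheory.LFunctions.Zhang2022.Repair.Bed
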